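import Summits.CriticalPhenomena.PercolationContinuityZ3.Theorems.Transplant.FKConnectivityAllQSPLaw
import Summits.CriticalPhenomena.PercolationContinuityZ3.Theorems.Transplant.FKConnectivityAllQSPDefs
import HarnessLib

/-!
# Connectivity correlation inequalities for `φ_{w,q}`, every `q > 0` — file 12: WAGNER'S INDUCTION — the determinant
# `C¹D⁰ − C⁰D¹ ≥ 0` is preserved by series and parallel composition, hence holds on every two-terminal series–parallel network

Support file (`--supports stmt-CriticalPhenomena-4575`), FK sub-lane `prim-bschramm-fk-2` (gen 7) of the post-continuity
programme; builds on p205010 (kernel theorem, internal audit signed; external expert review pending).  No definitions, no named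
facts, no sorries; standard axioms.

For a network `E` with terminals `s, t`, weights `w`, `q > 0` and a marked pair `f`, write (network masses `FK.netMass` of
`…AllQSPMassDefs.lean` / `…AllQSPLaw.lean`, `J_f = {f open}`) `C¹ = NM(s↔t, J_f)`, `C⁰ = NM(s↔t, J_fᶜ)`, `D¹ = NM(s↮t, J_f)`, `D⁰ = NM(s↮t, J_fᶜ)`.  The inequality
  (MONO)  `C⁰·D¹ ≤ C¹·D⁰`
says that, inside the network, the terminals are MORE likely to be joined when `f` is open than when it is closed.
* `FK.spMono_of_not_mem` — trivial if `f ∉ E` (`C¹ = D¹ = 0`); `FK.spMono_edge` — the single edge (`C⁰ = 0`).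
* `FK.spMono_series_alg` / `FK.spMono_parallel_alg` — pure algebra: under the series law the determinant of the composite is
  `C_K Z_K · (C¹D⁰ − C⁰D¹)` of the marked part, under the parallel law it is `D_K (D_K + q C_K) · (C¹D⁰ − C⁰D¹)`; both prefactors
  are `≥ 0` for `q ≥ 0` — this is the `2 × 2` transfer-matrix form of Wagner's two-sum theorem (2008, Thm. 5.8) for graphs, and
  the reason the range of `q` is not restricted.
* `FK.spMono_series` / `FK.spMono_parallel` — the composition steps (mark in either part).
* **`FK.spMono_of_isTTSP`** — (MONO) for every two-terminal series–parallel network `FK.IsTTSP E s t`, every `w`, every `q > 0`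
  and every pair `f`, by induction on the network.
The probabilistic consequences (EC⁺, pairwise positive correlation of connection events and the hub inequality for every `q > 0`,
edge-negative association for `q < 1`) are drawn in `…AllQSPWagner.lean`.
[cite: Wagner2006, Ex. 5.1, Thm. 5.8(d), §5.3] [cite: Grimmett2006, §3.8 Thm. (3.90) (pp. 61–62); §3.9 (pp. 63–64)]
-/

noncomputable section

namespace Summit.CriticalPhenomena.PercolationContinuityZ3.Theorems

namespace FK

open SimpleGraph Literature.Probability.LatticeModels Literature.Probability.Percolation
open Literature.Probability.Percolation.BHK2006 (weight)
open Literature.Probability.Percolation.DecisionTree (ind ind_of_mem ind_of_not_mem ind_nonneg)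
open scoped Classical

variable {V : Type*} [Fintype V]

/-! ### Trivial cases -/

/-- (MONO) is trivial for a pair off the network: both marked-open masses vanish. [folklore] -/
theorem spMono_of_not_mem (w : Sym2 V → unitInterval) (q : ℝ) {E : Set (Sym2 V)} (s t : V) {f : Sym2 V} (hf : f ∉ E) :
    netMass w q E (openConn s t ∩ {η | f ∈ η}ᶜ) * netMass w q E ((openConn s t)ᶜ ∩ {η | f ∈ η}) ≤
      netMass w q E (openConn s t ∩ {η | f ∈ η}) * netMass w q E ((openConn s t)ᶜ ∩ {η | f ∈ η}ᶜ) := by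
  rw [netMass_inter_openPair_of_not_mem w q hf, netMass_inter_openPair_of_not_mem w q hf, mul_zero, zero_mul]

/-- **(MONO) for a single edge** `{st}`, `s ≠ t`, `q ≥ 0`: with the edge closed the terminals are never joined, `C⁰ = 0`.
[cite: Wagner2006, Ex. 5.1] -/
theorem spMono_edge (w : Sym2 V → unitInterval) {q : ℝ} (hq : 0 ≤ q) {s t : V} (hst : s ≠ t) (f : Sym2 V) :
    netMass w q ({s(s, t)} : Set (Sym2 V)) (openConn s t ∩ {η | f ∈ η}ᶜ) *
        netMass w q ({s(s, t)} : Set (Sym2 V)) ((openConn s t)ᶜ ∩ {η | f ∈ η}) ≤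
      netMass w q ({s(s, t)} : Set (Sym2 V)) (openConn s t ∩ {η | f ∈ η}) *
        netMass w q ({s(s, t)} : Set (Sym2 V)) ((openConn s t)ᶜ ∩ {η | f ∈ η}ᶜ) := by
  by_cases hf : f = s(s, t)
  · subst hf
    rw [netMass_edge_conn_closed w q hst, zero_mul]
    exact mul_nonneg (netMass_nonneg w hq _ _) (netMass_nonneg w hq _ _)
  · have hf' : f ∉ ({s(s, t)} : Set (Sym2 V)) := hf
    exact spMono_of_not_mem w q s t hf'

/-! ### The algebra of the two composition steps -/

omit [Fintype V] in
/-- **Series step, algebra**: if `X·C^μ = C₁^μ·C_K`, `X·D^μ = C₁^μ·D_K + D₁^μ·Z_K` (`μ = 1, 0`) with `X > 0`, `C_K, Z_K ≥ 0` and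
`C₁⁰D₁¹ ≤ C₁¹D₁⁰`, then `C⁰D¹ ≤ C¹D⁰` — the composite determinant is `C_K Z_K` times the old one. [cite: Wagner2006, Thm. 5.8] -/
theorem spMono_series_alg {X C1 C0 D1 D0 c1 c0 d1 d0 CK DK ZK : ℝ} (hX : 0 < X) (hCK : 0 ≤ CK) (hZK : 0 ≤ ZK)
    (eC1 : X * C1 = c1 * CK) (eC0 : X * C0 = c0 * CK) (eD1 : X * D1 = c1 * DK + d1 * ZK) (eD0 : X * D0 = c0 * DK + d0 * ZK)
    (ih : c0 * d1 ≤ c1 * d0) : C0 * D1 ≤ C1 * D0 := by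
  have key : (X * C0) * (X * D1) ≤ (X * C1) * (X * D0) := by
    rw [eC1, eC0, eD1, eD0]
    nlinarith [mul_le_mul_of_nonneg_left ih (mul_nonneg hCK hZK)]
  have hX2 : 0 < X * X := mul_pos hX hX
  nlinarith [key]

omit [Fintype V] in
/-- **Parallel step, algebra**: if `X·C^μ = C₁^μ·D_K + D₁^μ·C_K + q·C₁^μ·C_K`, `X·D^μ = D₁^μ·D_K` (`μ = 1, 0`) with `X > 0`,
`q, C_K, D_K ≥ 0` and `C₁⁰D₁¹ ≤ C₁¹D₁⁰`, then `C⁰D¹ ≤ C¹D⁰` — the composite determinant is `D_K (D_K + q C_K)` times the old one.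
[cite: Wagner2006, Thm. 5.8] -/
theorem spMono_parallel_alg {X q C1 C0 D1 D0 c1 c0 d1 d0 CK DK : ℝ} (hX : 0 < X) (hq : 0 ≤ q) (hCK : 0 ≤ CK) (hDK : 0 ≤ DK)
    (eC1 : X * C1 = c1 * DK + d1 * CK + q * (c1 * CK)) (eC0 : X * C0 = c0 * DK + d0 * CK + q * (c0 * CK))
    (eD1 : X * D1 = d1 * DK) (eD0 : X * D0 = d0 * DK) (ih : c0 * d1 ≤ c1 * d0) : C0 * D1 ≤ C1 * D0 := by
  have key : (X * C0) * (X * D1) ≤ (X * C1) * (X * D0) := by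
    rw [eC1, eC0, eD1, eD0]
    nlinarith [mul_le_mul_of_nonneg_left ih (mul_nonneg hDK (add_nonneg hDK (mul_nonneg hq hCK)))]
  have hX2 : 0 < X * X := mul_pos hX hX
  nlinarith [key]

/-! ### The composition steps -/

section Steps

variable (w : Sym2 V → unitInterval) {q : ℝ} (hq : 0 < q) {E₁ E₂ : Set (Sym2 V)} {V₁ V₂ : Set V}
include hq

/-- **Series step, mark in the first part**: (MONO) for `(E₁; a, m)` at `f ∈ E₁` gives (MONO) for `(E₁ ∪ E₂; a, b)` at `f`.
[cite: Wagner2006, Thm. 5.8(d)] [cite: Grimmett2006, §3.8 Thm. (3.90) (p. 61)] -/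
theorem spMono_series_left (hd : Disjoint E₁ E₂) (h₁ : ∀ e ∈ E₁, ∀ z ∈ e, z ∈ V₁) (h₂ : ∀ e ∈ E₂, ∀ z ∈ e, z ∈ V₂)
    {a m b : V} (hS : V₁ ∩ V₂ ⊆ {m}) (haV₂ : a ∉ V₂) (hbV₁ : b ∉ V₁) (ham : a ≠ m) (hbm : b ≠ m) (hab : a ≠ b)
    {f : Sym2 V} (hf : f ∉ E₂)
    (ih : netMass w q E₁ (openConn a m ∩ {η | f ∈ η}ᶜ) * netMass w q E₁ ((openConn a m)ᶜ ∩ {η | f ∈ η}) ≤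
      netMass w q E₁ (openConn a m ∩ {η | f ∈ η}) * netMass w q E₁ ((openConn a m)ᶜ ∩ {η | f ∈ η}ᶜ)) :
    netMass w q (E₁ ∪ E₂) (openConn a b ∩ {η | f ∈ η}ᶜ) * netMass w q (E₁ ∪ E₂) ((openConn a b)ᶜ ∩ {η | f ∈ η}) ≤
      netMass w q (E₁ ∪ E₂) (openConn a b ∩ {η | f ∈ η}) * netMass w q (E₁ ∪ E₂) ((openConn a b)ᶜ ∩ {η | f ∈ η}ᶜ) :=
  spMono_series_alg (pow_pos hq (Fintype.card V)) (netMass_nonneg w hq.le E₂ (openConn m b))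
    (netMass_nonneg w hq.le E₂ Set.univ)
    (netMass_series_conn w q hd h₁ h₂ hS haV₂ hbV₁ ham hbm hab (markLocal_openPair hf))
    (netMass_series_conn w q hd h₁ h₂ hS haV₂ hbV₁ ham hbm hab (markLocal_compl_openPair hf))
    (netMass_series_disc w q hd h₁ h₂ hS haV₂ hbV₁ ham hbm hab (markLocal_openPair hf))
    (netMass_series_disc w q hd h₁ h₂ hS haV₂ hbV₁ ham hbm hab (markLocal_compl_openPair hf)) ih

/-- **Series step, mark in the second part**: (MONO) for `(E₂; m, b)` at `f ∈ E₂` gives (MONO) for `(E₁ ∪ E₂; a, b)` at `f`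
(the series law read from the other end). [cite: Wagner2006, Thm. 5.8(d)] [cite: Grimmett2006, §3.8 Thm. (3.90) (p. 61)] -/
theorem spMono_series_right (hd : Disjoint E₁ E₂) (h₁ : ∀ e ∈ E₁, ∀ z ∈ e, z ∈ V₁) (h₂ : ∀ e ∈ E₂, ∀ z ∈ e, z ∈ V₂)
    {a m b : V} (hS : V₁ ∩ V₂ ⊆ {m}) (haV₂ : a ∉ V₂) (hbV₁ : b ∉ V₁) (ham : a ≠ m) (hbm : b ≠ m) (hab : a ≠ b)
    {f : Sym2 V} (hf : f ∉ E₁)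
    (ih : netMass w q E₂ (openConn m b ∩ {η | f ∈ η}ᶜ) * netMass w q E₂ ((openConn m b)ᶜ ∩ {η | f ∈ η}) ≤
      netMass w q E₂ (openConn m b ∩ {η | f ∈ η}) * netMass w q E₂ ((openConn m b)ᶜ ∩ {η | f ∈ η}ᶜ)) :
    netMass w q (E₁ ∪ E₂) (openConn a b ∩ {η | f ∈ η}ᶜ) * netMass w q (E₁ ∪ E₂) ((openConn a b)ᶜ ∩ {η | f ∈ η}) ≤
      netMass w q (E₁ ∪ E₂) (openConn a b ∩ {η | f ∈ η}) * netMass w q (E₁ ∪ E₂) ((openConn a b)ᶜ ∩ {η | f ∈ η}ᶜ) := by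
  have hS' : V₂ ∩ V₁ ⊆ ({m} : Set V) := fun z hz => hS ⟨hz.2, hz.1⟩
  have hd' : Disjoint E₂ E₁ := hd.symm
  -- `{x ↔ y} = {y ↔ x}` (symmetry of reachability; cf. `openConn_comm'` elsewhere in the tree)
  have hc : ∀ x y : V, (openConn x y : Set (BondConfig V)) = openConn y x :=
    fun x y => Set.ext fun _ => ⟨Reachable.symm, Reachable.symm⟩
  rw [Set.union_comm, hc a b]
  rw [hc m b] at ih
  exact spMono_series_alg (pow_pos hq (Fintype.card V)) (netMass_nonneg w hq.le E₁ (openConn m a))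
    (netMass_nonneg w hq.le E₁ Set.univ)
    (netMass_series_conn w q hd' h₂ h₁ hS' hbV₁ haV₂ hbm ham (Ne.symm hab) (markLocal_openPair hf))
    (netMass_series_conn w q hd' h₂ h₁ hS' hbV₁ haV₂ hbm ham (Ne.symm hab) (markLocal_compl_openPair hf))
    (netMass_series_disc w q hd' h₂ h₁ hS' hbV₁ haV₂ hbm ham (Ne.symm hab) (markLocal_openPair hf))
    (netMass_series_disc w q hd' h₂ h₁ hS' hbV₁ haV₂ hbm ham (Ne.symm hab) (markLocal_compl_openPair hf)) ih

/-- **Parallel step, mark in the first part**: (MONO) for `(E₁; s, t)` at `f ∈ E₁` gives (MONO) for `(E₁ ∪ E₂; s, t)` at `f`.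
[cite: Wagner2006, Thm. 5.8(d)] [cite: Grimmett2006, §3.8 Thm. (3.91) (p. 62)] -/
theorem spMono_parallel_left (hd : Disjoint E₁ E₂) (h₁ : ∀ e ∈ E₁, ∀ z ∈ e, z ∈ V₁) (h₂ : ∀ e ∈ E₂, ∀ z ∈ e, z ∈ V₂)
    {s t : V} (hS : V₁ ∩ V₂ ⊆ {s, t}) (hst : s ≠ t) {f : Sym2 V} (hf : f ∉ E₂)
    (ih : netMass w q E₁ (openConn s t ∩ {η | f ∈ η}ᶜ) * netMass w q E₁ ((openConn s t)ᶜ ∩ {η | f ∈ η}) ≤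
      netMass w q E₁ (openConn s t ∩ {η | f ∈ η}) * netMass w q E₁ ((openConn s t)ᶜ ∩ {η | f ∈ η}ᶜ)) :
    netMass w q (E₁ ∪ E₂) (openConn s t ∩ {η | f ∈ η}ᶜ) * netMass w q (E₁ ∪ E₂) ((openConn s t)ᶜ ∩ {η | f ∈ η}) ≤
      netMass w q (E₁ ∪ E₂) (openConn s t ∩ {η | f ∈ η}) * netMass w q (E₁ ∪ E₂) ((openConn s t)ᶜ ∩ {η | f ∈ η}ᶜ) :=
  spMono_parallel_alg (pow_pos hq (Fintype.card V)) hq.le (netMass_nonneg w hq.le E₂ (openConn s t))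
    (netMass_nonneg w hq.le E₂ (openConn s t)ᶜ)
    (netMass_parallel_conn w q hd h₁ h₂ hS hst (markLocal_openPair hf))
    (netMass_parallel_conn w q hd h₁ h₂ hS hst (markLocal_compl_openPair hf))
    (netMass_parallel_disc w q hd h₁ h₂ hS hst (markLocal_openPair hf))
    (netMass_parallel_disc w q hd h₁ h₂ hS hst (markLocal_compl_openPair hf)) ih

/-- **Parallel step, mark in the second part** (the parallel law is symmetric in the parts).
[cite: Wagner2006, Thm. 5.8(d)] [cite: Grimmett2006, §3.8 Thm. (3.91) (p. 62)] -/
theorem spMono_parallel_right (hd : Disjoint E₁ E₂) (h₁ : ∀ e ∈ E₁, ∀ z ∈ e, z ∈ V₁) (h₂ : ∀ e ∈ E₂, ∀ z ∈ e, z ∈ V₂)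
    {s t : V} (hS : V₁ ∩ V₂ ⊆ {s, t}) (hst : s ≠ t) {f : Sym2 V} (hf : f ∉ E₁)
    (ih : netMass w q E₂ (openConn s t ∩ {η | f ∈ η}ᶜ) * netMass w q E₂ ((openConn s t)ᶜ ∩ {η | f ∈ η}) ≤
      netMass w q E₂ (openConn s t ∩ {η | f ∈ η}) * netMass w q E₂ ((openConn s t)ᶜ ∩ {η | f ∈ η}ᶜ)) :
    netMass w q (E₁ ∪ E₂) (openConn s t ∩ {η | f ∈ η}ᶜ) * netMass w q (E₁ ∪ E₂) ((openConn s t)ᶜ ∩ {η | f ∈ η}) ≤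
      netMass w q (E₁ ∪ E₂) (openConn s t ∩ {η | f ∈ η}) * netMass w q (E₁ ∪ E₂) ((openConn s t)ᶜ ∩ {η | f ∈ η}ᶜ) := by
  have hS' : V₂ ∩ V₁ ⊆ ({s, t} : Set V) := fun z hz => hS ⟨hz.2, hz.1⟩
  rw [Set.union_comm]
  exact spMono_parallel_left w hq hd.symm h₂ h₁ hS' hst hf ih

end Steps

/-! ### Structural facts about two-terminal series–parallel networks -/

section Structure

variable {E : Finset (Sym2 V)} {s t : V}

omit [Fintype V] in
/-- The left terminal of a network lies on one of its edges. [folklore] -/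
theorem IsTTSP.left_mem (h : IsTTSP E s t) : ∃ e ∈ E, s ∈ e := by
  induction h with
  | edge hst => exact ⟨_, Finset.mem_singleton_self _, Sym2.mem_mk_left _ _⟩
  | series _ _ _ _ _ _ ih₁ _ =>
    obtain ⟨e, he, hs⟩ := ih₁
    exact ⟨e, Finset.mem_union_left _ he, hs⟩
  | parallel _ _ _ _ ih₁ _ =>
    obtain ⟨e, he, hs⟩ := ih₁
    exact ⟨e, Finset.mem_union_left _ he, hs⟩

omit [Fintype V] in
/-- The right terminal of a network lies on one of its edges. [folklore] -/
theorem IsTTSP.right_mem (h : IsTTSP E s t) : ∃ e ∈ E, t ∈ e := by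
  induction h with
  | edge hst => exact ⟨_, Finset.mem_singleton_self _, Sym2.mem_mk_right _ _⟩
  | series _ _ _ _ _ _ _ ih₂ =>
    obtain ⟨e, he, ht⟩ := ih₂
    exact ⟨e, Finset.mem_union_right _ he, ht⟩
  | parallel _ _ _ _ _ ih₂ =>
    obtain ⟨e, he, ht⟩ := ih₂
    exact ⟨e, Finset.mem_union_right _ he, ht⟩

omit [Fintype V] in
/-- The terminals of a network are distinct. [folklore] -/
theorem IsTTSP.ne (h : IsTTSP E s t) : s ≠ t := by
  induction h with
  | edge hst => exact hst
  | series h₁ h₂ _ _ ha _ _ _ =>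
    obtain ⟨e, he, ht⟩ := h₂.right_mem
    intro hab
    exact ha e he (hab ▸ ht)
  | parallel _ _ _ _ ih₁ _ => exact ih₁

end Structure

/-! ### (MONO) on every two-terminal series–parallel network -/

/-- **Wagner's induction**: for every two-terminal series–parallel network `E` with terminals `s, t`, every weight vector `w`,
every `q > 0` and every pair `f`, `C⁰·D¹ ≤ C¹·D⁰` — inside the network, `{s ↔ t}` is positively correlated with `{f open}`
(masses read on `ω ∩ E` under the product weight, cluster factor `q^{k(ω ∩ E)}`).
[cite: Wagner2006, Ex. 5.1, Thm. 5.8(d), §5.3] [cite: Grimmett2006, §3.8 Thm. (3.90)–(3.91) (pp. 61–62)] -/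
theorem spMono_of_isTTSP (w : Sym2 V → unitInterval) {q : ℝ} (hq : 0 < q) {E : Finset (Sym2 V)} {s t : V}
    (h : IsTTSP E s t) (f : Sym2 V) :
    netMass w q (↑E : Set (Sym2 V)) (openConn s t ∩ {η | f ∈ η}ᶜ) * netMass w q (↑E : Set (Sym2 V)) ((openConn s t)ᶜ ∩ {η | f ∈ η}) ≤
      netMass w q (↑E : Set (Sym2 V)) (openConn s t ∩ {η | f ∈ η}) *
        netMass w q (↑E : Set (Sym2 V)) ((openConn s t)ᶜ ∩ {η | f ∈ η}ᶜ) := by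
  induction h with
  | @edge s t hst =>
    rw [Finset.coe_singleton]
    exact spMono_edge w hq.le hst f
  | @series E₁ E₂ a m b h₁ h₂ hd hV ha hb ih₁ ih₂ =>
    rw [Finset.coe_union]
    have g₁ : ∀ e ∈ (↑E₁ : Set (Sym2 V)), ∀ z ∈ e, z ∈ {z : V | ∃ e ∈ E₁, z ∈ e} := fun e he z hz => ⟨e, he, hz⟩
    have g₂ : ∀ e ∈ (↑E₂ : Set (Sym2 V)), ∀ z ∈ e, z ∈ {z : V | ∃ e ∈ E₂, z ∈ e} := fun e he z hz => ⟨e, he, hz⟩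
    have gS : {z : V | ∃ e ∈ E₁, z ∈ e} ∩ {z : V | ∃ e ∈ E₂, z ∈ e} ⊆ ({m} : Set V) :=
      fun z hz => hV z hz.1 hz.2
    have gaV₂ : a ∉ {z : V | ∃ e ∈ E₂, z ∈ e} := fun ⟨e, he, hae⟩ => ha e he hae
    have gbV₁ : b ∉ {z : V | ∃ e ∈ E₁, z ∈ e} := fun ⟨e, he, hbe⟩ => hb e he hbe
    have gam : a ≠ m := by
      obtain ⟨e, he, hme⟩ := h₂.left_mem
      intro ham; exact ha e he (ham ▸ hme)
    have gbm : b ≠ m := by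
      obtain ⟨e, he, hme⟩ := h₁.right_mem
      intro hbm; exact hb e he (hbm ▸ hme)
    have gab : a ≠ b := by
      obtain ⟨e, he, hae⟩ := h₁.left_mem
      intro hab; exact hb e he (hab ▸ hae)
    have gd : Disjoint (↑E₁ : Set (Sym2 V)) ↑E₂ := Finset.disjoint_coe.2 hd
    by_cases hf₁ : f ∈ E₁
    · have hf₂ : f ∉ (↑E₂ : Set (Sym2 V)) := fun h => Finset.disjoint_left.1 hd hf₁ h
      exact spMono_series_left w hq gd g₁ g₂ gS gaV₂ gbV₁ gam gbm gab hf₂ ih₁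
    · by_cases hf₂ : f ∈ E₂
      · exact spMono_series_right w hq gd g₁ g₂ gS gaV₂ gbV₁ gam gbm gab (show f ∉ (↑E₁ : Set (Sym2 V)) from hf₁) ih₂
      · have hf : f ∉ (↑E₁ : Set (Sym2 V)) ∪ ↑E₂ := by
          rintro (h | h)
          · exact hf₁ h
          · exact hf₂ h
        exact spMono_of_not_mem w q a b hf
  | @parallel E₁ E₂ s t h₁ h₂ hd hV ih₁ ih₂ =>
    rw [Finset.coe_union]
    have g₁ : ∀ e ∈ (↑E₁ : Set (Sym2 V)), ∀ z ∈ e, z ∈ {z : V | ∃ e ∈ E₁, z ∈ e} := fun e he z hz => ⟨e, he, hz⟩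
    have g₂ : ∀ e ∈ (↑E₂ : Set (Sym2 V)), ∀ z ∈ e, z ∈ {z : V | ∃ e ∈ E₂, z ∈ e} := fun e he z hz => ⟨e, he, hz⟩
    have gS : {z : V | ∃ e ∈ E₁, z ∈ e} ∩ {z : V | ∃ e ∈ E₂, z ∈ e} ⊆ ({s, t} : Set V) := by
      intro z hz
      rcases hV z hz.1 hz.2 with h | h
      · exact Or.inl h
      · exact Or.inr h
    have gst : s ≠ t := h₁.ne
    have gd : Disjoint (↑E₁ : Set (Sym2 V)) ↑E₂ := Finset.disjoint_coe.2 hd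
    by_cases hf₁ : f ∈ E₁
    · have hf₂ : f ∉ (↑E₂ : Set (Sym2 V)) := fun h => Finset.disjoint_left.1 hd hf₁ h
      exact spMono_parallel_left w hq gd g₁ g₂ gS gst hf₂ ih₁
    · by_cases hf₂ : f ∈ E₂
      · exact spMono_parallel_right w hq gd g₁ g₂ gS gst (show f ∉ (↑E₁ : Set (Sym2 V)) from hf₁) ih₂
      · have hf : f ∉ (↑E₁ : Set (Sym2 V)) ∪ ↑E₂ := by
          rintro (h | h)
          · exact hf₁ h
          · exact hf₂ h
        exact spMono_of_not_mem w q s t hf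

end FK

end Summit.CriticalPhenomena.PercolationContinuityZ3.Theorems

end
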